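import Summits.Ventures.CertifiedManyBodySolver.Observables.GHFClassFloor
import Literature.MathematicalPhysics.QuantumLattice.HubbardNNNHoppingInteractionTorus
import Literature.MathematicalPhysics.QuantumLattice.HubbardNNNHoppingParticleHole
import Literature.MathematicalPhysics.QuantumLattice.HubbardFreePropagator
import HarnessLib

/-!
# Ventures/CertifiedManyBodySolver — Observables/GHFClassFloorTPrime.lean
# The gHF-class floor with next-nearest-neighbour hopping: `e ≥ -4(t² + t'²)/U - (U/2) n (1 - n)` (even torus)

HONEST FRAMING: first certified bounds; not a superconductivity verdict; every number certified or labelled float.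
A competing-order EXCLUSION removes a named class of candidate ground states; it never says which order is present;
no phase sentence follows.

Cell `hubbard-tc` (MO-S3, D-0096), seat `hubbard-tc-mod-3` (G3), `prover-hubbard-tc-mod-3-g9-0`. Companion of
`GHFClassFloor.lean` (the complete generalised-Hartree–Fock class X1-GHF and its hypothesis-free floor
`re_expect_hubbardTorusTT'_ge_ghfClass` with the symbolic hopping mass `Σ_{xy}|A_{xy}|²`). Here the hopping mass of the
`t–t'` matrix is evaluated on the EVEN torus `(ℤ/Lℤ)²`, `L ≥ 4`: `Σ_{x,y}|A_{xy}|² = 4(t² + t'²)L²` (`sum_norm_sq_ttHopMatrix`: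
four nearest and four next-nearest neighbours per site; NO pair of sites is both — nearest neighbours carry opposite
bipartite signs `(-1)^{x₁+x₂}`, diagonal neighbours equal signs), whence the per-site floor of the class for the cuprate-type
model with `t' ≠ 0`: **`e ≥ -4(t² + t'²)/U - (U/2) n (1 - n)`**, at half filling `e ≥ -4(t² + t'²)/U`
(`ghfClass_energy_per_site_ge_tt'`, `_halfFilling_tt'`). No certified cap exists today at `(U, 1, t' ≠ 0)` (cell §E W3-12),
so no word is filed on it; the statement is the device for future La/Hg parent-compound boxes (`t'/t ≈ -0.1…-0.3`).
Everything PROVED (0 sorry, no definition, standard axioms). WHAT THIS IS NOT: a phase word; «AF order absent».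

Tree search — REUSED: `GHFClassFloor.re_expect_hubbardTorusTT'_ge_ghfClass` (p566284); `TTPrimeFree.ttHopMatrix`,
`LangerMattis.hopMatrix`; `torusStagger_eq_neg_of_adj_holds` (`HubbardModelProofs`), `torusStagger_eq_of_diagAdj`
(`HubbardNNNHoppingParticleHole`); `sum_ite_torusDiagGraph_adj` (`HubbardNNNHoppingInteractionTorus`);
`card_filter_fermionTorusGraph_adj` (`HubbardGroundStateLatticeCovariance`); `FermionTorus.sum_eq_sum_torusSite`
(`HubbardFreePropagator`); `card_fermionTorus_eq`. Mathlib: `Int.units_eq_one_or`.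

References: V. Bach, E. H. Lieb, J. P. Solovej, J. Stat. Phys. 76 (1994) 3, §2 eq. (2c.36) [BachLiebSolovej1994];
H. Xu et al., Science 384 (2024) eadh7691, eq. (1) (the `t–t'` model) [XuEtAl2024]; S. Friedli, Y. Velenik (2017) §3.1
[FriedliVelenik2017].
-/

noncomputable section

namespace Summit.Ventures.CertifiedManyBodySolver.Observables

namespace GHFClassFloor

open Literature.MathematicalPhysics.QuantumLattice
open Matrix Finset Literature.Probability.LatticeModels
  Literature.MathematicalPhysics.QuantumLattice.RayleighBound
  Literature.MathematicalPhysics.QuantumLattice.HubbardBandBottom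
  Literature.MathematicalPhysics.QuantumLattice.LangerMattis
  Literature.MathematicalPhysics.QuantumLattice.TTPrimeFree
open scoped ComplexOrder ComplexConjugate

variable {L : ℕ} [NeZero L]

omit [NeZero L] in
/-- On the even torus no pair of sites is both a nearest and a next-nearest neighbour (bipartite signs: opposite
along an edge, equal along a diagonal). [cite: FriedliVelenik2017, §3.1] -/
theorem not_diagAdj_of_adj (hLe : Even L) {x y : FermionTorus 2 L} (h : (fermionTorusGraph 2 L).Adj x y) :
    ¬ (fermionTorusDiagGraph L).Adj x y := by
  intro h'
  have e1 := torusStagger_eq_neg_of_adj_holds hLe h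
  have e2 := torusStagger_eq_of_diagAdj hLe h'
  rw [e2] at e1
  rcases Int.units_eq_one_or (torusStagger y) with hu | hu <;> rw [hu] at e1 <;> exact absurd e1 (by decide)

/-- **`Σ_{x,y} |A_{xy}|² = 4(t² + t'²)L²`** for the `t–t'` hopping matrix on the even torus `(ℤ/Lℤ)²`, `L ≥ 3`
(four nearest + four diagonal neighbours per site, the two families disjoint). [cite: FriedliVelenik2017, §3.1] -/
theorem sum_norm_sq_ttHopMatrix (hL : 3 ≤ L) (hLe : Even L) (t t' : ℝ) :
    ∑ x : FermionTorus 2 L, ∑ y : FermionTorus 2 L, ‖ttHopMatrix L t t' x y‖ ^ 2 =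
      4 * (t ^ 2 + t' ^ 2) * (L : ℝ) ^ 2 := by
  classical
  have hxy : ∀ x y : FermionTorus 2 L, ‖ttHopMatrix L t t' x y‖ ^ 2 =
      (if (fermionTorusGraph 2 L).Adj x y then t ^ 2 else 0) +
        (if (fermionTorusDiagGraph L).Adj x y then t' ^ 2 else 0) := by
    intro x y
    simp only [ttHopMatrix, hopMatrix, Matrix.add_apply, Matrix.of_apply]
    by_cases h1 : (fermionTorusGraph 2 L).Adj x y
    · have h2 := not_diagAdj_of_adj hLe h1
      rw [if_pos h1, if_neg h2, if_pos h1, if_neg h2, add_zero, add_zero, Complex.norm_real, Real.norm_eq_abs,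
        sq_abs, neg_sq]
    · rw [if_neg h1, if_neg h1, zero_add, zero_add]
      by_cases h2 : (fermionTorusDiagGraph L).Adj x y
      · rw [if_pos h2, if_pos h2, Complex.norm_real, Real.norm_eq_abs, sq_abs, neg_sq]
      · rw [if_neg h2, if_neg h2]; simp
  have hnn : ∀ x : FermionTorus 2 L,
      ∑ y, (if (fermionTorusGraph 2 L).Adj x y then t ^ 2 else (0 : ℝ)) = 4 * t ^ 2 := by
    intro x
    rw [Finset.sum_ite, Finset.sum_const_zero, add_zero, Finset.sum_const,
      card_filter_fermionTorusGraph_adj hL x, nsmul_eq_mul]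
    push_cast; ring
  have hdiag : ∀ x : FermionTorus 2 L,
      ∑ y, (if (fermionTorusDiagGraph L).Adj x y then t' ^ 2 else (0 : ℝ)) = 4 * t' ^ 2 := by
    intro x
    rw [FermionTorus.sum_eq_sum_torusSite]
    have hadj : ∀ z : TorusSite 2 L, (fermionTorusDiagGraph L).Adj x (FermionTorus.ofTorusSite z) ↔
        (torusDiagGraph L).Adj x.toTorusSite z := by
      intro z
      show (torusDiagGraph L).Adj x.toTorusSite (FermionTorus.ofTorusSite z).toTorusSite ↔ _
      rw [FermionTorus.toTorusSite_ofTorusSite]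
    simp only [hadj]
    rw [sum_ite_torusDiagGraph_adj hL x.toTorusSite (fun _ => t' ^ 2), Fin.sum_univ_two]
    ring
  simp_rw [hxy, Finset.sum_add_distrib, hnn, hdiag]
  simp only [Finset.sum_const, Finset.card_univ, card_fermionTorus_eq, nsmul_eq_mul]
  push_cast; ring

/-- **Per-site floor of the gHF class with `t'` (even torus `L ≥ 4`, every `U > 0`, every filling):
`e ≥ -4(t² + t'²)/U - (U/2) n (1 - n)`.** [cite: BachLiebSolovej1994, §2 eq. (2c.36)] -/
theorem ghfClass_energy_per_site_ge_tt' (hL : 3 ≤ L) (hLe : Even L) (t t' : ℝ) {U n : ℝ} (hU : 0 < U)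
    {φ : Fock (Orb (FermionTorus 2 L))} (hφ : φ ≠ 0)
    (hN : (star φ ⬝ᵥ (totalNumber *ᵥ φ)).re = n * (L : ℝ) ^ 2 * normSq φ)
    (hD : (n ^ 2 / 4) * (L : ℝ) ^ 2 * normSq φ * normSq φ -
        ∑ x : FermionTorus 2 L, (((star φ ⬝ᵥ ((numberOp x 0 - numberOp x 1) *ᵥ φ)).re) ^ 2 / 4 +
          ‖star φ ⬝ᵥ ((creation (orb x 0) * annihilation (orb x 1)) *ᵥ φ)‖ ^ 2) ≤
      (star φ ⬝ᵥ ((∑ x : FermionTorus 2 L, numberOp x 0 * numberOp x 1) *ᵥ φ)).re * normSq φ) :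
    -4 * (t ^ 2 + t' ^ 2) / U - U / 2 * n * (1 - n) ≤
      (star φ ⬝ᵥ (hubbardTorusTT' L t t' U *ᵥ φ)).re / ((L : ℝ) ^ 2 * normSq φ) := by
  have h := re_expect_hubbardTorusTT'_ge_ghfClass t t' hU φ hN hD
  rw [sum_norm_sq_ttHopMatrix hL hLe t t'] at h
  have hpos : 0 < normSq φ := by
    rcases (normSq_nonneg φ).lt_or_eq with hlt | heq
    · exact hlt
    · exact absurd (HubbardBandBottom.eq_zero_of_normSq_eq_zero heq.symm) hφ
  have hL0 : (0 : ℝ) < (L : ℝ) ^ 2 := by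
    have : (0 : ℝ) < L := by exact_mod_cast (lt_of_lt_of_le (by norm_num : 0 < 3) hL)
    positivity
  rw [le_div_iff₀ (mul_pos hL0 hpos)]
  have e : -(4 * (t ^ 2 + t' ^ 2) * (L : ℝ) ^ 2) / (U * (L : ℝ) ^ 2) = -4 * (t ^ 2 + t' ^ 2) / U := by
    field_simp
  rw [e] at h
  linarith

/-- **Half filling with `t'`: every state of the gHF class has `e ≥ -4(t² + t'²)/U`** (even torus `L ≥ 4`, `U > 0`).
[cite: BachLiebSolovej1994, Thm. 4.5] -/
theorem ghfClass_energy_per_site_ge_halfFilling_tt' (hL : 3 ≤ L) (hLe : Even L) (t t' : ℝ) {U : ℝ} (hU : 0 < U)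
    {φ : Fock (Orb (FermionTorus 2 L))} (hφ : φ ≠ 0)
    (hN : (star φ ⬝ᵥ (totalNumber *ᵥ φ)).re = 1 * (L : ℝ) ^ 2 * normSq φ)
    (hD : ((1 : ℝ) ^ 2 / 4) * (L : ℝ) ^ 2 * normSq φ * normSq φ -
        ∑ x : FermionTorus 2 L, (((star φ ⬝ᵥ ((numberOp x 0 - numberOp x 1) *ᵥ φ)).re) ^ 2 / 4 +
          ‖star φ ⬝ᵥ ((creation (orb x 0) * annihilation (orb x 1)) *ᵥ φ)‖ ^ 2) ≤
      (star φ ⬝ᵥ ((∑ x : FermionTorus 2 L, numberOp x 0 * numberOp x 1) *ᵥ φ)).re * normSq φ) :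
    -4 * (t ^ 2 + t' ^ 2) / U ≤ (star φ ⬝ᵥ (hubbardTorusTT' L t t' U *ᵥ φ)).re / ((L : ℝ) ^ 2 * normSq φ) := by
  have h := ghfClass_energy_per_site_ge_tt' hL hLe t t' hU hφ hN hD
  linarith

end GHFClassFloor

end Summit.Ventures.CertifiedManyBodySolver.Observables

end
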